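import Summits.BirchSwinnertonDyer.BirchSwinnertonDyer.Theorems.ByReductionTypeAtTwoOrdKatoOptimalLedger
import Summits.BirchSwinnertonDyer.BirchSwinnertonDyer.Theorems.TwoAdicConverseLambdaHalfBridge
import Summits.BirchSwinnertonDyer.Rank1Residual.X5.TwoAdicTargetsPub
import Summits.BirchSwinnertonDyer.Rank1Residual.X1.LambdaSqueezeAlgebra
import HarnessLib

/-!
# Crux `OrdKatoHalfAtTwoIso` (stmt-BirchSwinnertonDyer-19573), idea `lambda-rigidity-heegner-floor` — SKETCH

Crux-ideate gen 4, ideator 2. The LEVER: **`λ`-rigidity lifts the `T = 0` floor to `Λ`.** On the honest residue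
of the crux (DD12: `ρ̄_{W,2}` onto, `ρ_{W,2^∞}` of index 2, i.e. `ℚ(√Δ) = ℚ(i)`, analytic rank 0) nothing
cyclotomic works (no Kolyvagin prime `ℓ ≡ 1 (2^k)` with rank-one Frobenius — by-product F1 of gen 3). Here the
`Λ`-adic input is Euler-system-FREE: Kato's theorem in `Λ ⊗ ℚ` (`h17`, PRINT at `p = 2`) plus the `λ`-HALF
`λ(L₂) ≤ λ(X)` (crux 19556 `OrdLambdaHalfAtTwo`, by name) force `char X` and `ϖ·L₂` to have THE SAME
distinguished polynomial; then `μ(X) ≤ μ(ϖ L₂)` — the whole item (`KatoOrdTwoMuPart`: item ⟺ `μ`-part) — is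
EQUIVALENT to one inequality of `2`-adic valuations at `T = 0`: `ord₂ f_X(0) ≤ ord₂ (ϖ L₂)(0)`
(`§1`, kernel-checked: `μ(M) − ord M(0) = μ(f) − ord f(0)` whenever `M = a·f` with `λ(a) = 0`). At analytic rank
`0` that inequality is, by Greenberg 4.1@2 + Mazur–Tate–Teitelbaum + GZK (the tree's G11a′ dictionary),
EXACTLY `ord₂ #Ш(E) ≤ ord₂ #Ш_an(E)` = `MissingUpperBoundAt W 2` — a statement about ONE curve over `ℚ`,
attackable by the ANTICYCLOTOMIC Euler system (Heegner points + Kolyvagin at `l = 2`), where the involution is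
complex conjugation `c`, which on the residue (`Δ < 0`, so `T₂E ≅ ℤ₂[C₂]`) is a PERFECT rank-one element
(`T/(c−1)T ≅ ℤ₂`, torsion-free) — the structure the cyclotomic direction lacks (F2 of gen 3).

Stubs (sorried): `stub_heegner_floor` (XL, research: Kolyvagin B₂ + structure at `2` for the index-2 image,
exact `2`-part), `stub_t0_dictionary` (M: the G11a′ bookkeeping read upward), `stub_neron_integral_residue`
(S/M: `ϖ·L₂ ∈ Λ` for `E[2]` irreducible). PROVED here: §1 (rigidity algebra), §2 (the `Λ`-lift
`KatoMuPartAtTwo W` from `λ`-half + floor), §4 (the crux BY NAME from the stubs + binders B7/B8 + PUB + 19556).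
BSD is not proved; items 19556/19573 stay OPEN; nothing asserted.
-/

set_option linter.dupNamespace false
set_option autoImplicit false

noncomputable section

open scoped Classical MatrixGroups ModularForm

open CongruenceSubgroup WeierstrassCurve Literature.NumberTheory.EllipticCurves
  Literature.NumberTheory.EllipticCurves.ModularForms
  Literature.NumberTheory.EllipticCurves.Rank1Residual
  Literature.NumberTheory.EllipticCurves.Rank1Residual.Typed
  Literature.NumberTheory.EllipticCurves.Greenberg1999
  Summit.BirchSwinnertonDyer.Rank1Residual.X1.MuLambda
  Summit.BirchSwinnertonDyer.Rank1Residual.X1.MuPart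
  Summit.BirchSwinnertonDyer.Rank1Residual.X1.ParitySqueeze
  Summit.BirchSwinnertonDyer.Rank1Residual.Iwasawa
  Summit.BirchSwinnertonDyer.Rank1Residual
  Summit.BirchSwinnertonDyer.Rank1Residual.X5
  Summit.BirchSwinnertonDyer.Rank1Residual.X5.O1
  Summit.BirchSwinnertonDyer.BirchSwinnertonDyer.Theses.ByReductionTypeAtTwo
  Summit.BirchSwinnertonDyer.BirchSwinnertonDyer.Theorems.OrdKatoIntAtTwo
  Summit.BirchSwinnertonDyer.BirchSwinnertonDyer.Theorems.OrdKatoOptimalAtTwo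
  Summit.BirchSwinnertonDyer.BirchSwinnertonDyer.Theorems.TwoAdicTwistConverse
  Summit.BirchSwinnertonDyer.BirchSwinnertonDyer.Theorems

namespace Summit.BirchSwinnertonDyer.BirchSwinnertonDyer.Cruxes.OrdKatoHalfAtTwoIso.LambdaRigidityFloor

/-! ## §1 `λ`-rigidity (pure algebra in `Λ = ℤ_p⟦T⟧`, PROVED) -/

section Algebra

variable {p : ℕ} [Fact p.Prime]

/-- **`λ`-RIGIDITY.** If `a · f = M` in `Λ` with `λ(a) = 0` (so `a = p^{μ(a)}·unit`, `ord_p a(0) = μ(a)`) and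
`M(0) ≠ 0`, then `μ(M) − ord_p M(0) = μ(f) − ord_p f(0)`: the `μ`-defect equals the defect of constant terms.
[folklore] -/
theorem mu_sub_val_eq_of_mul_eq {a f M : IwasawaAlgebra p} (ha : a ≠ 0) (hf : f ≠ 0) (hkey : a * f = M)
    (hlam : lam a = 0) (hM0 : PowerSeries.constantCoeff M ≠ 0) :
    (mu M : ℤ) - (((PowerSeries.constantCoeff M : ℤ_[p]) : ℚ_[p])).valuation =
      (mu f : ℤ) - (((PowerSeries.constantCoeff f : ℤ_[p]) : ℚ_[p])).valuation := by
  have eμ : mu M = mu a + mu f := by rw [← hkey, mu_mul ha hf]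
  have e0 : PowerSeries.constantCoeff M = PowerSeries.constantCoeff a * PowerSeries.constantCoeff f := by
    rw [← hkey, map_mul]
  obtain ⟨ha0, hva⟩ := valuation_constantCoeff_of_lam_eq_zero ha hlam
  have hf0 : ((PowerSeries.constantCoeff f : ℤ_[p]) : ℚ_[p]) ≠ 0 := by
    intro h0
    apply hM0
    rw [e0, (PadicInt.coe_eq_zero.mp h0 : PowerSeries.constantCoeff f = 0), mul_zero]
  have hv : (((PowerSeries.constantCoeff M : ℤ_[p]) : ℚ_[p])).valuation =
      (((PowerSeries.constantCoeff a : ℤ_[p]) : ℚ_[p])).valuation +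
        (((PowerSeries.constantCoeff f : ℤ_[p]) : ℚ_[p])).valuation := by
    rw [e0, PadicInt.coe_mul, Padic.valuation_mul ha0 hf0]
  rw [hv, eμ, hva]
  push_cast
  ring

/-- **Scalar shift**: for a nonzero constant `y ∈ ℤ_p` and `L(0) ≠ 0`, `μ(y·L) − ord (y·L)(0) = μ(L) − ord L(0)`
(`λ(C y) = 0`, `LambdaConstPinch.lam_C`). [folklore] -/
theorem mu_sub_val_C_mul_eq {y : ℤ_[p]} (hy : y ≠ 0) {L : IwasawaAlgebra p} (hL : L ≠ 0)
    (hL0 : PowerSeries.constantCoeff L ≠ 0) :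
    (mu (PowerSeries.C y * L) : ℤ) -
        (((PowerSeries.constantCoeff (PowerSeries.C y * L) : ℤ_[p]) : ℚ_[p])).valuation =
      (mu L : ℤ) - (((PowerSeries.constantCoeff L : ℤ_[p]) : ℚ_[p])).valuation := by
  have hCy0 : (PowerSeries.C y : IwasawaAlgebra p) ≠ 0 := by
    rw [Ne, ← map_zero (PowerSeries.C (R := ℤ_[p])), PowerSeries.C_injective.eq_iff]; exact hy
  have hM0 : PowerSeries.constantCoeff (PowerSeries.C y * L) ≠ 0 := by
    rw [map_mul, PowerSeries.constantCoeff_C]; exact mul_ne_zero hy hL0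
  exact mu_sub_val_eq_of_mul_eq hCy0 hL rfl (LambdaConstPinch.lam_C hy) hM0

/-- **The `μ`-inequality from `λ`-rigidity and the floor.** `a·f = C y · L` with `λ(a) = 0`, `y ≠ 0`,
`L(0) ≠ 0`, and the FLOOR `ord f(0) ≤ ord L(0)` ⟹ `μ(f) ≤ μ(L)`. [folklore] -/
theorem mu_le_mu_of_floor {a f L : IwasawaAlgebra p} {y : ℤ_[p]} (ha : a ≠ 0) (hf : f ≠ 0) (hL : L ≠ 0)
    (hy : y ≠ 0) (hkey : a * f = PowerSeries.C y * L) (hlam : lam a = 0)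
    (hL0 : PowerSeries.constantCoeff L ≠ 0)
    (hfloor : (((PowerSeries.constantCoeff f : ℤ_[p]) : ℚ_[p])).valuation ≤
      (((PowerSeries.constantCoeff L : ℤ_[p]) : ℚ_[p])).valuation) : mu f ≤ mu L := by
  have hM0 : PowerSeries.constantCoeff (PowerSeries.C y * L) ≠ 0 := by
    rw [map_mul, PowerSeries.constantCoeff_C]; exact mul_ne_zero hy hL0
  have h1 := mu_sub_val_eq_of_mul_eq ha hf hkey hlam hM0
  have h2 := mu_sub_val_C_mul_eq hy hL hL0
  have h3 : (mu f : ℤ) ≤ mu L := by linarith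
  exact_mod_cast h3

end Algebra

/-! ## §2 The `Λ`-lift at one curve: `KatoMuPartAtTwo W` from Kato⊗ℚ + `λ`-half + the `T = 0` floor (PROVED) -/

section Lift

variable (W : WeierstrassCurve ℚ) [W.IsElliptic] [W.IsGloballyMinimal]

/-- **The floor in Iwasawa currency at `W`**: for every cyclotomic datum, generator `f_X` of `char_Λ X(E/ℚ_∞)`
and Néron-normalised `L₀` (`ι L₀ = ϖ·L₂(f,α)`) with `L₀(0) ≠ 0`: `ord₂ f_X(0) ≤ ord₂ L₀(0)`. At analytic rank
`0` this is `ord₂ #Ш(E) ≤ ord₂ #Ш(E)_an` (`stub_t0_dictionary`). Plain `def` (per-curve predicate). [folklore] -/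
def IwasawaFloorAtTwo : Prop :=
  ∀ (κ : ZpExtension ℚ 2) (γ : Field.absoluteGaloisGroup ℚ),
      κ.IsCyclotomic → κ.IsTopGenerator γ → IsCyclotomicVariable 2 γ → IsOrdinaryAt W 2 →
    ∀ [NeZero (W.conductorNorm ℤ)] (f : CuspForm (Gamma0 (W.conductorNorm ℤ)) 2),
      IsNewformOf W f → ∀ (ϖ : ℚ), (ϖ : ℝ) * W.realPeriodRat = plusPeriod f →
    ∀ (D : W.SelmerDualData κ γ) (fE : IwasawaAlgebra 2), D.charIdeal = Ideal.span {fE} →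
    ∀ (L₀ : IwasawaAlgebra 2),
      iwasawaToPowerSeries 2 L₀ = PowerSeries.C (ϖ : ℚ_[2]) * padicLFunction f (unitRoot W 2 : ℚ_[2]) →
      PowerSeries.constantCoeff L₀ ≠ 0 →
      (((PowerSeries.constantCoeff fE : ℤ_[2]) : ℚ_[2])).valuation ≤
        (((PowerSeries.constantCoeff L₀ : ℤ_[2]) : ℚ_[2])).valuation

omit [W.IsGloballyMinimal] in
/-- `ι (C x) = C x` for an integral constant. [folklore] -/
theorem iota_C (x : ℤ_[2]) :
    iwasawaToPowerSeries 2 (PowerSeries.C x) = PowerSeries.C ((x : ℚ_[2])) := by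
  rw [iwasawaToPowerSeries, PowerSeries.map_C]; rfl

/-- **At analytic rank `0` the Néron-normalised `L₀` has `L₀(0) ≠ 0`**: `L₀(0) = ϖ·(1 − α⁻¹)²·[0]⁺_f` (MTT
interpolation), `ϖ ≠ 0`, `1 − α⁻¹ = u·#Ẽ(𝔽₂) ≠ 0`, `[0]⁺_f ≠ 0 ⟺ L(E,1) ≠ 0`. [cite: MTT1986, §I.14 (interpolation at the trivial character)] -/
theorem constantCoeff_ne_zero_of_analyticRank_eq_zero (hord : IsOrdinaryAt W 2) (hr : W.analyticRank = 0)
    [NeZero (W.conductorNorm ℤ)] {f : CuspForm (Gamma0 (W.conductorNorm ℤ)) 2} (hf : IsNewformOf W f)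
    {ϖ : ℚ} (hϖ : (ϖ : ℝ) * W.realPeriodRat = plusPeriod f) {L₀ : IwasawaAlgebra 2}
    (hL₀ : iwasawaToPowerSeries 2 L₀ =
      PowerSeries.C (ϖ : ℚ_[2]) * padicLFunction f (unitRoot W 2 : ℚ_[2])) :
    PowerSeries.constantCoeff L₀ ≠ 0 := by
  have hL : W.entireLFunction 1 ≠ 0 := (W.analyticRank_eq_zero_iff_holds hf.hasEntireLFunction).mp hr
  have hϖ0 : ϖ ≠ 0 := varpi_ne_zero hf hϖ
  set s : ℚ := ratPlusSymbol f 0 with hs_def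
  have hs0 : s ≠ 0 := by
    intro h0
    apply hL
    rw [hf.entireLFunction_one_eq, ← hs_def, h0]
    simp
  set a : ℚ_[2] := ((unitRoot W 2 : ℤ_[2]) : ℚ_[2]) with ha
  obtain ⟨u₂, hu₂⟩ := exists_unit_one_sub_unitRoot_inv 2 W hord
  have hN0 : (W.reductionPointCount 2 : ℚ_[2]) ≠ 0 := by
    rw [WeierstrassCurve.reductionPointCount]
    exact_mod_cast Nat.card_pos.ne'
  have h1a : (1 - a⁻¹) ≠ 0 := by
    rw [ha, hu₂]; exact mul_ne_zero (coe_units_ne_zero 2 u₂) hN0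
  have hι0 : ((PowerSeries.constantCoeff L₀ : ℤ_[2]) : ℚ_[2]) =
      (ϖ : ℚ_[2]) * (1 - a⁻¹) ^ 2 * (s : ℚ_[2]) := by
    rw [← constantCoeff_iwasawaToPowerSeries 2 L₀, hL₀, map_mul, PowerSeries.constantCoeff_C,
      constantCoeff_padicLFunction_unitRoot hord hf]
    ring
  intro h0
  rw [h0, PadicInt.coe_zero] at hι0
  have hϖQ : (ϖ : ℚ_[2]) ≠ 0 := by exact_mod_cast hϖ0
  have hsQ : (s : ℚ_[2]) ≠ 0 := by exact_mod_cast hs0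
  exact mul_ne_zero (mul_ne_zero hϖQ (pow_ne_zero 2 h1a)) hsQ hι0.symm

/-- **THE `Λ`-LIFT (kernel of the idea).** At a globally minimal `W`, good ordinary at `2`, analytic rank `0`:
Kato's Thm. 17.4 (1)(2) at `2` (`h17`, PRINT: `X` torsion, `char X ∣ 2ⁿ·ϖ·L₂` in `Λ`) + the `λ`-half
`LambdaHalfAtTwo W` (item 19556 at `W`) + the floor `IwasawaFloorAtTwo W` ⟹ `KatoMuPartAtTwo W`
(`2^{μ(X)} ∣ L₀`). Proof: `(num ϖ·a)·f_X = 2ⁿ·den ϖ·L₀` (`exists_mul_charGen_eq_of_kato_allPrimes`); `λ` of both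
sides: `λ(a′) + λ(f_X) = λ(L₀) = λ(L₂-multiple) ≤ λ(X) = λ(f_X)`, so `λ(a′) = 0`; `λ`-rigidity (§1) turns the floor
into `μ(f_X) ≤ μ(L₀)`, and `μ(f_X) = μ(X)`. [cite: Kato2004Asterisque, Thm. 17.4 (1)(2) (p. 273)]
[cite: SkinnerUrban2014, proof of Thm. 3.6.4 (p. 43) (two inclusions ⇒ equality; shape)] -/
theorem katoMuPartAtTwo_of_lambdaHalf_of_floor
    (h17 : ∀ [NeZero (W.conductorNorm ℤ)] (f : CuspForm (Gamma0 (W.conductorNorm ℤ)) 2),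
      kato_divisibility_allPrimes W 2 (f := f))
    (hr : W.analyticRank = 0) (hlh : LambdaHalfAtTwo W) (hfloor : IwasawaFloorAtTwo W) :
    KatoMuPartAtTwo W := by
  intro κ γ hκ hγ hγ' hord _ f hf ϖ hϖ D L₀ hL₀
  haveI : Module.Finite (IwasawaAlgebra 2) D.X := D.module_finite_holds hγ
  by_cases hL₀0 : L₀ = 0
  · rw [hL₀0]; exact dvd_zero _
  obtain ⟨fE, hfE⟩ := (charIdeal_isPrincipal_holds 2 D.X).principal
  have hchar : D.charIdeal = Ideal.span {fE} := hfE
  obtain ⟨hD, a, n, hkey⟩ :=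
    MuZeroUpgrade.exists_mul_charGen_eq_of_kato_allPrimes W 2 (h17 f) hκ hγ hγ' hord hf D hchar hL₀
  -- non-vanishing bookkeeping
  have hden0 : ((ϖ.den : ℕ) : ℤ_[2]) ≠ 0 := by exact_mod_cast ϖ.den_nz
  set m : ℕ := 2 ^ n * ϖ.den with hm_def
  have hm0 : m ≠ 0 := mul_ne_zero (pow_ne_zero _ two_ne_zero) ϖ.den_nz
  set y : ℤ_[2] := (m : ℤ_[2]) with hy_def
  have hy0 : y ≠ 0 := by rw [hy_def]; exact_mod_cast hm0
  have hkey' : (PowerSeries.C (ϖ.num : ℤ_[2]) * a) * fE = PowerSeries.C y * L₀ := by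
    rw [hkey, ← mul_assoc, ← map_mul, hy_def, hm_def]
    push_cast
    rfl
  have hcast : ((((m : ℚ) * ϖ : ℚ)) : ℚ_[2]) = ((y : ℤ_[2]) : ℚ_[2]) * (ϖ : ℚ_[2]) := by
    rw [hy_def]
    push_cast
    rfl
  have hCy0 : (PowerSeries.C y : IwasawaAlgebra 2) ≠ 0 := by
    rw [Ne, ← map_zero (PowerSeries.C (R := ℤ_[2])), PowerSeries.C_injective.eq_iff]; exact hy0
  have hM0 : PowerSeries.C y * L₀ ≠ 0 := mul_ne_zero hCy0 hL₀0
  have hfE0 : fE ≠ 0 := by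
    rintro rfl
    rw [mul_zero] at hkey'
    exact hM0 hkey'.symm
  set a' : IwasawaAlgebra 2 := PowerSeries.C (ϖ.num : ℤ_[2]) * a with ha'_def
  have ha'0 : a' ≠ 0 := by
    intro h0
    rw [h0, zero_mul] at hkey'
    exact hM0 hkey'.symm
  -- the `λ`-half kills `λ(a′)`
  obtain ⟨c, L₁, hL₁0, hL₁, hlamL₁⟩ := hlh κ γ hκ hγ hγ' hord f hf D
  have hlamfE : lam fE = D.lambda := lam_generator_eq_lambdaInvariant D.X hD hfE0 hchar
  have hιM : iwasawaToPowerSeries 2 (PowerSeries.C y * L₀) =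
      PowerSeries.C ((((m : ℚ) * ϖ : ℚ)) : ℚ_[2]) *
        padicLFunction f (unitRoot W 2 : ℚ_[2]) := by
    rw [map_mul, iota_C, hL₀, ← mul_assoc, ← map_mul, hcast]
  have hlamM : lam (PowerSeries.C y * L₀) = lam L₁ := lam_eq_of_eq_C_mul hM0 hL₁0 hιM hL₁
  have e := congrArg lam hkey'
  rw [lam_mul ha'0 hfE0, hlamM] at e
  have hlama' : lam a' = 0 := by
    have : lam L₁ ≤ lam fE := hlamfE ▸ hlamL₁
    omega
  -- the floor at this datum
  have hL₀c0 : PowerSeries.constantCoeff L₀ ≠ 0 :=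
    constantCoeff_ne_zero_of_analyticRank_eq_zero W hord hr hf hϖ hL₀
  have hfl := hfloor κ γ hκ hγ hγ' hord f hf ϖ hϖ D fE hchar L₀ hL₀ hL₀c0
  -- `λ`-rigidity ⟹ `μ(f_X) ≤ μ(L₀)`
  have hle : mu fE ≤ mu L₀ := mu_le_mu_of_floor ha'0 hfE0 hL₀0 hy0 hkey' hlama' hL₀c0 hfl
  have hμfE : mu fE = D.mu := mu_generator_eq_muInvariant D.X hD hfE0 hchar
  rw [← hμfE]
  exact (map_dvd PowerSeries.C (pow_dvd_pow _ hle)).trans (C_pow_mu_dvd hL₀0)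

/-- **The typed item at `W` itself** from the lift + the landed bridge `μ`-part ⟹ item (needs the Néron
integrality certificate `hint`). [cite: Kato2004Asterisque, Thm. 17.4 (1)(2) (p. 273)] -/
theorem mainConjectureLowerDivisibilityAtTwoOrd_of_lambdaHalf_of_floor
    (h17 : ∀ [NeZero (W.conductorNorm ℤ)] (f : CuspForm (Gamma0 (W.conductorNorm ℤ)) 2),
      kato_divisibility_allPrimes W 2 (f := f))
    (hint : ∀ [NeZero (W.conductorNorm ℤ)] (f : CuspForm (Gamma0 (W.conductorNorm ℤ)) 2),
      IsNewformOf W f → ∀ ϖ : ℚ, (ϖ : ℝ) * W.realPeriodRat = plusPeriod f →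
        ∃ L₀ : IwasawaAlgebra 2, iwasawaToPowerSeries 2 L₀ =
          PowerSeries.C (ϖ : ℚ_[2]) * padicLFunction f (unitRoot W 2 : ℚ_[2]))
    (hr : W.analyticRank = 0) (hlh : LambdaHalfAtTwo W) (hfloor : IwasawaFloorAtTwo W) :
    MainConjectureLowerDivisibilityAtTwoOrd W :=
  mainConjectureLowerDivisibilityAtTwoOrd_of_katoMuPartAtTwo W h17 hint
    (katoMuPartAtTwo_of_lambdaHalf_of_floor W h17 hr hlh hfloor)

/-- **stub (M) — the `T = 0` DICTIONARY read upward.** At analytic rank `0`, good ordinary `2`: Greenberg's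
Thm. 4.1 at `2` (`f_X(0) ~ ∏c_ℓ · #Ẽ(𝔽₂)(2)² · #Sel / #E(ℚ)(2)²`), MTT interpolation
(`L₀(0) = ϖ(1−α⁻¹)²[0]⁺_f`, `1−α⁻¹ ~ #Ẽ(𝔽₂)`), GZK (`#Ш_an = (L(E,1)/Ω)·#E(ℚ)²/∏c_ℓ`, `Ш` finite) give
`ord₂ L₀(0) − ord₂ f_X(0) = ord₂ #Ш_an − ord₂ #Ш`; hence `MissingUpperBoundAt W 2 ⟹ IwasawaFloorAtTwo W`.
The same lines as the tree's `chainUpperAtTwo_of_divisibilityRat` (Steps 0–8), read in the other direction.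
[cite: GreenbergLNM1716, Thm. 4.1 (p. 102)] [cite: MTT1986, §I.14] [cite: Miller2011LMS, Def. 1.1] -/
def T0DictionaryAtTwo : Prop :=
  ∀ (W : WeierstrassCurve ℚ) [W.IsElliptic] [W.IsGloballyMinimal],
    TwoAdicEulerCharRankZero W 0 → rank_eq_analyticRank_of_analyticRank_le_one →
    (∀ [NeZero (W.conductorNorm ℤ)] (f : CuspForm (Gamma0 (W.conductorNorm ℤ)) 2),
      kato_divisibility_allPrimes W 2 (f := f)) →
    W.analyticRank = 0 → GoodOrd W 2 → MissingUpperBoundAt W 2 → IwasawaFloorAtTwo W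

theorem stub_t0_dictionary : T0DictionaryAtTwo := by
  sorry

end Lift

/-! ## §3 The residue `∀`-closures (the two RESEARCH stubs + one support stub) -/

/-- **stub (XL, research, LOAD-BEARING) — the HEEGNER FLOOR on the DD12 residue.** For every globally minimal
non-CM `W`, analytic rank `0`, good ordinary at `2`, `ρ̄_{W,2}` onto, `ρ_{W,2^∞}` NOT onto (⟺ `ℚ(√Δ) = ℚ(i)` on
this class; `Δ < 0`): `ord₂ #Ш(E/ℚ) ≤ ord₂ #Ш(E/ℚ)_an`. Engine: a Heegner field `K ⊄ ℚ(E[2^∞])`, Kolyvagin's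
Theorem B₂ and structure theorem at `l = 2` for the INDEX-2 image `{g : sgn(g mod 2) = χ₋₄(det g)}` (contains
all scalars; `E[2]` absolutely irreducible; `c` acts on `T₂E ≅ ℤ₂[C₂]` with `T/(c−1)T ≅ ℤ₂`), Gross–Zagier
exact at `2`, Manin constant odd. NOT in print (Kolyvagin 1989 Thm. B_l at `l = 2` demands `GL₂(ℤ₂)`-image);
decidable per curve (`2`-power descent). [cite: Kolyvagin1989Izv, Thm. B_l (l = 2), p. 475–476]
[cite: GrossZagier1986, Thm. I.6.3] -/
def ResidueHeegnerFloorTwo : Prop :=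
  ∀ (W : WeierstrassCurve ℚ) [W.IsElliptic] [W.IsGloballyMinimal],
    ¬ W.HasCM → W.analyticRank = 0 → GoodOrd W 2 → W.HasSurjectiveModNGaloisRep 2 →
    ¬ O1.TwoAdicSurjective W → MissingUpperBoundAt W 2

/-- **stub (= crux 19556 restricted) — the `λ`-half on the residue.** Implied BY NAME by
`TwoAdicTwistConverse.OrdLambdaHalfAtTwo` (item stmt-BirchSwinnertonDyer-19556, OPEN, Euler-system-free, shared
with route TwoAdicConverse and with the pen's 19577 sandwich line). [cite: GreenbergVatsal2000, p. 4 (after Thm. (1.2)) (shape)] -/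
def ResidueLambdaHalfTwo : Prop :=
  ∀ (W : WeierstrassCurve ℚ) [W.IsElliptic] [W.IsGloballyMinimal],
    ¬ W.HasCM → W.analyticRank = 0 → GoodOrd W 2 → W.HasSurjectiveModNGaloisRep 2 →
    ¬ O1.TwoAdicSurjective W → LambdaHalfAtTwo W

/-- **stub (S/M, support) — Néron `2`-integrality on the residue**: `ϖ·L₂(f,α) ∈ Λ` when `E[2]` is
irreducible (Stevens/GV Prop. 3.7 shape: modular symbols are integral w.r.t. the Néron lattice away from the
Manin constant, which is odd for `E[2]` irreducible / semistable-at-2). Already INSIDE the route's residue binder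
`OrdKatoHalfDD12ResidueTwo` (its item body implies it). [cite: GreenbergVatsal2000, Prop. 3.7 (shape; p odd in print)] -/
def ResidueNeronIntegralTwo : Prop :=
  ∀ (W : WeierstrassCurve ℚ) [W.IsElliptic] [W.IsGloballyMinimal],
    ¬ W.HasCM → W.analyticRank = 0 → GoodOrd W 2 → W.HasSurjectiveModNGaloisRep 2 →
    ¬ O1.TwoAdicSurjective W →
    ∀ [NeZero (W.conductorNorm ℤ)] (f : CuspForm (Gamma0 (W.conductorNorm ℤ)) 2),
      IsNewformOf W f → ∀ ϖ : ℚ, (ϖ : ℝ) * W.realPeriodRat = plusPeriod f →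
        ∃ L₀ : IwasawaAlgebra 2, iwasawaToPowerSeries 2 L₀ =
          PowerSeries.C (ϖ : ℚ_[2]) * padicLFunction f (unitRoot W 2 : ℚ_[2])

theorem stub_heegner_floor : ResidueHeegnerFloorTwo := by
  sorry

theorem stub_neron_integral_residue : ResidueNeronIntegralTwo := by
  sorry

/-- Crux 19556 BY NAME ⟹ the residue `λ`-half (restriction). [folklore] -/
theorem residueLambdaHalfTwo_of_ordLambdaHalfAtTwo (h : TwoAdicTwistConverse.OrdLambdaHalfAtTwo) :
    ResidueLambdaHalfTwo :=
  fun W _ _ hcm _ hgo _ _ => h W hcm hgo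

/-! ## §4 The crux BY NAME (PROVED modulo the stubs, binders B7/B8, PUB and crux 19556) -/

/-- **The residue binder at analytic rank `0` from the floor, the `λ`-half and integrality** (rank-0 variant of
the route's OPEN `OrdKatoHalfDD12ResidueTwo`), modulo PUB (Kato 17.4 (1)(2) at `2`, Greenberg 4.1, GZK).
[cite: Kato2004Asterisque, Thm. 17.4 (1)(2) (p. 273)] [cite: GreenbergLNM1716, Thm. 4.1 (p. 102)] -/
theorem residue_item_of_floor (hPub : Literature.Uncategorized.OrdPublishedInputsAtTwo)
    (hT : T0DictionaryAtTwo)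
    (hF : ResidueHeegnerFloorTwo) (hL : ResidueLambdaHalfTwo) (hI : ResidueNeronIntegralTwo)
    (W : WeierstrassCurve ℚ) [W.IsElliptic] [W.IsGloballyMinimal] (hcm : ¬ W.HasCM)
    (hr : W.analyticRank = 0) (hgo : GoodOrd W 2) (him : W.HasSurjectiveModNGaloisRep 2)
    (hinf : ¬ O1.TwoAdicSurjective W) : MainConjectureLowerDivisibilityAtTwoOrd W := by
  obtain ⟨_, hGZK, h17, h41⟩ := hPub
  have hEC : TwoAdicEulerCharRankZero W 0 := twoAdicEulerCharRankZero_zero_of_greenberg W h41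
  exact mainConjectureLowerDivisibilityAtTwoOrd_of_lambdaHalf_of_floor W (fun f => h17 W f)
    (fun f hf ϖ hϖ => hI W hcm hr hgo him hinf f hf ϖ hϖ) hr (hL W hcm hr hgo him hinf)
    (hT W hEC hGZK (fun f => h17 W f) hr hgo (hF W hcm hr hgo him hinf))

/-- **THE CRUX `OrdKatoHalfAtTwoIso` (stmt-BirchSwinnertonDyer-19573) BY NAME** from: the two displayed binders
of the route's image trichotomy (`KatoMuPartAtOptimalMemberOfNotSurjectiveTwo` = B7 for `ρ̄₂` not onto;
`KatoIntAtGoodOrdSurjectiveTwo` = B8 for `ρ_{2^∞}` onto), PUB, and — on the DD12 residue, replacing the OPEN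
residue binder `OrdKatoHalfDD12ResidueTwo` — the Heegner floor + the `λ`-half + Néron integrality.
[cite: Kato2004Asterisque, Thm. 17.4 (1)(2) (p. 273)] -/
theorem ordKatoHalfAtTwoIso_of_floor (hPub : Literature.Uncategorized.OrdPublishedInputsAtTwo)
    (hB7 : KatoMuPartAtOptimalMemberOfNotSurjectiveTwo) (hB8 : KatoIntAtGoodOrdSurjectiveTwo)
    (hT : T0DictionaryAtTwo)
    (hF : ResidueHeegnerFloorTwo) (hL : ResidueLambdaHalfTwo) (hI : ResidueNeronIntegralTwo) :
    OrdKatoHalfAtTwoIso := by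
  intro W _ _ hcm hr hgo
  have hPub' := hPub
  obtain ⟨_, _, h17, _⟩ := hPub'
  by_cases him : W.HasSurjectiveModNGaloisRep 2
  · by_cases hinf : O1.TwoAdicSurjective W
    · exact ⟨W, ‹_›, ‹_›, isIsogenous_self W, hB8 W hgo hinf⟩
    · exact ⟨W, ‹_›, ‹_›, isIsogenous_self W,
        residue_item_of_floor hPub hT hF hL hI W hcm hr hgo him hinf⟩
  · exact exists_isIsogenous_mainConjectureLowerDivisibilityAtTwoOrd_of_binder W hB7 h17 hcm hgo him

/-- **Skeleton composition** (stubs ⟹ crux, BY NAME, no sorry in this proof; the route's support/aside items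
PUB, B7, B8 and crux 19556 `OrdLambdaHalfAtTwo` are consumed BY NAME). -/
theorem OrdKatoHalfAtTwoIso_of (hPub : Literature.Uncategorized.OrdPublishedInputsAtTwo)
    (hB7 : KatoMuPartAtOptimalMemberOfNotSurjectiveTwo) (hB8 : KatoIntAtGoodOrdSurjectiveTwo)
    (h19556 : TwoAdicTwistConverse.OrdLambdaHalfAtTwo) :
    T0DictionaryAtTwo → ResidueHeegnerFloorTwo → ResidueNeronIntegralTwo →
      Summit.BirchSwinnertonDyer.BirchSwinnertonDyer.Theses.ByReductionTypeAtTwo.OrdKatoHalfAtTwoIso :=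
  fun hT hF hI => ordKatoHalfAtTwoIso_of_floor hPub hB7 hB8 hT hF
    (residueLambdaHalfTwo_of_ordLambdaHalfAtTwo h19556) hI

end Summit.BirchSwinnertonDyer.BirchSwinnertonDyer.Cruxes.OrdKatoHalfAtTwoIso.LambdaRigidityFloor

end
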